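import Summits.BirchSwinnertonDyer.BirchSwinnertonDyer.Theorems.EisensteinPrimesBSDpOnCellCTwistCertificate
import HarnessLib

/-!
# Crux 4 `BSDpOnCellC` (stmt-BirchSwinnertonDyer-19034), line b1 v9: the TWIST-CERTIFICATE road with the
# certificate on a curve ISOGENOUS to the twist — CENSUS SHAPES (RULING L71 (a); cell `bsd-eis`, seat
# `bsd-eis-cgshw` g16; the «§5» of `Theorems/EisensteinPrimesBSDpOnCellCTwistCertificate.lean`, filed as a
# sibling module because that file sits at the 400-line cap)

HONEST FRAMING (cell `bsd-eis`, run/shared/lean/pub/bsd-eis/): theorems only; kernel compositions of files already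
in the tree; every theorem is CONDITIONAL on its displayed binders — above all Keller–Yin arXiv:2402.12781v2
Thm. D [PREPRINT] and, on the value side, the REFEREED Liu–Zhang–Zhang fact through k5-c4's glue; nothing booked;
X2 stays CONSTRUCTION-SHAPED; no label or count moves; BSD is proved for no curve by this file.

PARTITION (D-0054): corner X2 row B11 ψ-ODD sub-rows (`CellCNonsplitGV`, `CellCSplitGV`) × crux 4 -19034 —
the `model=iso` census rows of the twist-certificate extension kit j274617 (cgshw g15): cells whose admissible
twist `E^{(d_K)}` has `p ∣ #Ш_an` on its minimal model but `p ∤ #Ш_an` on a `ℚ`-ISOGENOUS curve (Cassels moves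
`BSD_p` along the isogeny). Of record: ONE such cell, `439698ce1 @3` (`d_K = −167`; `#Ш_an = 36` on the twist,
`4` on the `3`-isogenous curve) — the last open B11 cell after referee B ROUND 737.

* `bsdp_of_cellC_of_isogenousTwistShaUnit_of_lzzRoadInputIoo_of_thmD_OPEN` — v9's published bundle (`hPub`) +
  Wuthrich 2014 Prop. 21 (`hW21`) + the typed input `X2.LZZRoadInputIoo` (`hL`) + Keller–Yin Thm. D BY NAME (`hD`) +
  (pair, admissible `K`, minimal model `Wd` of the twist, `Wc ∼ Wd` over `ℚ`, `p ∤ #Ш(Wc)_an`) ⊢ `BSDp W p` —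
  the §4 door `Reoriented.bsdp_of_cellC_of_isogenousTwistShaUnit` with `h2 / h3n / h3s` discharged exactly as §3
  discharges them for §2 (`X2.bdpValueContinuousDisplayAt_of_lzzRoadInputIoo`,
  `X2.forall_{nonsplit,split}IMCEqOnTreeIntOther_of_thmD_OPEN`).
* `bsdp_of_cellC_of_isogenousTwistShaUnit_of_thm151_thm153_of_thmD_OPEN` — the same at FACT level (Liu–Zhang–Zhang
  Duke 167 Thm. 1.5.1 ∧ 1.5.3, `hF`, through `X2.lzzRoadInputIoo_of_thm151_thm153`, p515022).

What this is NOT: not a class-wide theorem on the ψ-odd rows (crux 3 `MazurMCOnCellB` remains their class-wide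
input); not a count move (referee B's word on the planner's OFFER decides); the certificate `p ∤ #Ш(Wc)_an` is a
per-pair numeric reading (two engines: cgshw j274617 ‖ planner JD #32 j278346).

References: [KellerYin2024] Thm. D = Thm. 5.1.3 (PRE); [LiuZhangZhang2018] Thm. 1.5.1, Rem. 1.1.2, Thm. 1.5.3;
[Wuthrich2014] Prop. 21 (p. 400); [MilneADT2006] Thm. I.7.3 (Cassels); [CastellaEtAl2021] Thm. 5.3.1; [Hsieh2014]
Thm. 1; [Mazur1978] Cor. 4.1; [Miller2011LMS] Def. 1.1; RULING L71 (a); cgshw MEMO-19 §7 (B), MEMO-20.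
-/

set_option autoImplicit false
set_option linter.dupNamespace false

noncomputable section

open scoped Classical MatrixGroups ModularForm Topology

open Filter CongruenceSubgroup WeierstrassCurve NumberField IsDedekindDomain Field PowerSeries
  Literature.NumberTheory.EllipticCurves Literature.NumberTheory.EllipticCurves.GreenbergSelmer
  Literature.NumberTheory.EllipticCurves.ModularForms Literature.NumberTheory.QuadraticFields
  Literature.NumberTheory.EllipticCurves.Rank1Residual
  Literature.NumberTheory.EllipticCurves.Rank1Residual.Typed
  Literature.NumberTheory.EllipticCurves.KrizLi2019
  Literature.NumberTheory.EllipticCurves.GreenbergVatsal2000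
  Literature.NumberTheory.EllipticCurves.Wuthrich2014
  Literature.NumberTheory.EllipticCurves.SteinWuthrich2013
  Literature.NumberTheory.EllipticCurves.Castella2018
  Literature.NumberTheory.EllipticCurves.Castella2018Exceptional
  Literature.NumberTheory.GaloisRepresentations Literature.NumberTheory.GaloisCohomology
  Literature.NumberTheory.Automorphic
  Summit.BirchSwinnertonDyer.Rank1Residual.X11b.AcSelmer
  Summit.BirchSwinnertonDyer.Rank1Residual.X11b.Halves
  Summit.BirchSwinnertonDyer.Rank1Residual.X11b
  Summit.BirchSwinnertonDyer.Rank1Residual.X2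
  Summit.BirchSwinnertonDyer.Rank1Residual

namespace Summit.BirchSwinnertonDyer.BirchSwinnertonDyer.Theorems.Reoriented

/-! ### §5 Census shapes of the isogenous-certificate door (§4) -/

section IsogenousCensus

/-- **PER-PAIR TWIST-CERTIFICATE ROAD, certificate on an ISOGENOUS curve, census shape:** from v9's
`stub_publishedFacts` bundle VERBATIM (`hPub`), Wuthrich 2014 Prop. 21 (`hW21`), the typed LZZ input
`X2.LZZRoadInputIoo` (`hL`) and Keller–Yin Thm. D BY NAME (`hD`): for every X2c pair `(W, p)` of EITHER ψ-parity,
every admissible `K`, every globally minimal model `Wd` of `E^{(d_K)}`, every globally minimal `Wc` `ℚ`-isogenous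
to `Wd` with `p ∤ #Ш(Wc)_an`, `BSD(E,p)` holds — the §4 door with its value atom (`h2`) from
`X2.bdpValueContinuousDisplayAt_of_lzzRoadInputIoo` and its IMC atoms (`h3n`/`h3s`) from
`X2.forall_{nonsplit,split}IMCEqOnTreeIntOther_of_thmD_OPEN`, exactly as §3 does for §2. A `conditional-result`;
nothing booked. [claim: KellerYin2024, status: under-review]
[cite: KellerYin2024, Thm. D = Thm. 5.1.3 (arXiv:2402.12781v2 L306–L309)]
[cite: LiuZhangZhang2018, Thm. 1.5.1 and Thm. 1.5.3 (Duke 167 pp. 748–749) (source of the input; nothing asserted)]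
[cite: Wuthrich2014, Prop. 21 (p. 400)] [cite: MilneADT2006, Thm. I.7.3] [cite: Miller2011LMS, Def. 1.1] -/
theorem bsdp_of_cellC_of_isogenousTwistShaUnit_of_lzzRoadInputIoo_of_thmD_OPEN
    (hPub : (lambdaMu_multiplicative_of_gvPar ∧ thm16_charIdeal_dvd_multiplicative_of_reducible ∧
      thm61_splitMultiplicative ∧ thm61_nonsplitMultiplicative ∧
      (∀ (W : WeierstrassCurve ℚ) [W.IsElliptic] [W.IsGloballyMinimal] (p : ℕ) [Fact p.Prime],
        greenberg_stevens (W := W) (p := p)) ∧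
      exists_isNewformOf ∧
      (∀ (K : Type) [Field K] [NumberField K], poitouTate_selmerStructure_duality K) ∧
      (∀ (K : Type) [Field K] [NumberField K], poitouTate_sha_tateDual K) ∧
      hsieh2014_exists_anticyclotomicPAdicLFunction ∧
      (∀ (N : ℕ) [NeZero N] (W : WeierstrassCurve ℚ) (K : Type) [Field K] [NumberField K],
        gross_zagier N W K) ∧
      (∀ (N : ℕ) [NeZero N] (W : WeierstrassCurve ℚ) (K : Type) [Field K] [NumberField K],
        kolyvagin N W K) ∧
      rank_eq_analyticRank_of_analyticRank_le_one ∧ HoffsteinLuo1997_exists_twist_L_one_ne_zero ∧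
      mazur_not_dvd_maninConstant_of_odd ∧ bsdRHS_eq_of_isIsogenous) ∧
      thm210_thm211_bdpDisplay_pNew)
    (hW21 : sha_dvd_analyticSha) (hL : X2.LZZRoadInputIoo)
    (hD : KellerYin2024.thmD_imcMult_exists_isBDPLFunction_isTorsion_charIdeal_eq_OPEN)
    (W : WeierstrassCurve ℚ) [W.IsElliptic] [W.IsGloballyMinimal] (p : ℕ) [Fact p.Prime] (hc : CellC W p)
    (K : Type) [Field K] [NumberField K] (hK : IsImaginaryQuadratic K)
    (hodd : Odd (NumberField.discr K)) (hlt : NumberField.discr K < -4)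
    (hHN : SatisfiesHeegnerHypothesis (W.conductorNorm ℤ) K) (hHp : SatisfiesHeegnerHypothesis p K)
    (hLK : (W.quadraticTwist (NumberField.discr K : ℚ)).entireLFunction 1 ≠ 0)
    (Wd : WeierstrassCurve ℚ) [Wd.IsElliptic] [Wd.IsGloballyMinimal]
    (hWd : ∃ C : VariableChange ℚ, C • Wd = W.quadraticTwist (NumberField.discr K : ℚ))
    (Wc : WeierstrassCurve ℚ) [Wc.IsElliptic] [Wc.IsGloballyMinimal] (hiso : IsIsogenous Wd Wc)
    (hunit : ∃ q : ℚ, shaAn Wc = (q : ℂ) ∧ padicValRat p q = 0) : BSDp W p := by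
  obtain ⟨⟨-, -, -, -, -, hnf, hPT, hPT2, hH, hGZ, hKo, hGZK, -, hMaz, hCassels⟩, -⟩ := hPub
  exact bsdp_of_cellC_of_isogenousTwistShaUnit W p hW21 hnf hPT hPT2 hH hGZ hKo hGZK hMaz hCassels
    (fun W' _ _ _ ↦ X2.bdpValueContinuousDisplayAt_of_lzzRoadInputIoo hL W' p)
    (fun W' _ _ hc' hns ↦ X2.forall_nonsplitIMCEqOnTreeIntOther_of_thmD_OPEN hD W' p hc' hns)
    (fun W' _ _ hc' hs ↦ X2.forall_splitIMCEqOnTreeIntOther_of_thmD_OPEN hD W' p hc' hs)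
    hc K hK hodd hlt hHN hHp hLK Wd hWd Wc hiso hunit

/-- **PER-PAIR TWIST-CERTIFICATE ROAD, certificate on an ISOGENOUS curve, FACT LEVEL:** as the previous theorem
with the REFEREED Liu–Zhang–Zhang fact (`hF`, Duke 167 Thm. 1.5.1 ∧ 1.5.3 at `p ‖ N`, typed p509230) in place of the
typed input, through k5-c4's glue `X2.lzzRoadInputIoo_of_thm151_thm153` (p515022). Binders: v9's published bundle +
Wuthrich 2014 Prop. 21 + the LZZ fact + Keller–Yin Thm. D [PRE] + (pair, admissible `K`, minimal model `Wd` of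
the twist, `Wc ∼ Wd`, `p ∤ #Ш(Wc)_an`). The door named by RULING L71 (a). A `conditional-result`; nothing booked.
[claim: KellerYin2024, status: under-review] [cite: KellerYin2024, Thm. D = Thm. 5.1.3 (arXiv:2402.12781v2 L306–L309)]
[cite: LiuZhangZhang2018, Thm. 1.5.1 and Remark 1.1.2 and Thm. 1.5.3 (Duke 167 pp. 745–749)]
[cite: Wuthrich2014, Prop. 21 (p. 400)] [cite: MilneADT2006, Thm. I.7.3] [cite: Miller2011LMS, Def. 1.1] -/
theorem bsdp_of_cellC_of_isogenousTwistShaUnit_of_thm151_thm153_of_thmD_OPEN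
    (hPub : (lambdaMu_multiplicative_of_gvPar ∧ thm16_charIdeal_dvd_multiplicative_of_reducible ∧
      thm61_splitMultiplicative ∧ thm61_nonsplitMultiplicative ∧
      (∀ (W : WeierstrassCurve ℚ) [W.IsElliptic] [W.IsGloballyMinimal] (p : ℕ) [Fact p.Prime],
        greenberg_stevens (W := W) (p := p)) ∧
      exists_isNewformOf ∧
      (∀ (K : Type) [Field K] [NumberField K], poitouTate_selmerStructure_duality K) ∧
      (∀ (K : Type) [Field K] [NumberField K], poitouTate_sha_tateDual K) ∧
      hsieh2014_exists_anticyclotomicPAdicLFunction ∧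
      (∀ (N : ℕ) [NeZero N] (W : WeierstrassCurve ℚ) (K : Type) [Field K] [NumberField K],
        gross_zagier N W K) ∧
      (∀ (N : ℕ) [NeZero N] (W : WeierstrassCurve ℚ) (K : Type) [Field K] [NumberField K],
        kolyvagin N W K) ∧
      rank_eq_analyticRank_of_analyticRank_le_one ∧ HoffsteinLuo1997_exists_twist_L_one_ne_zero ∧
      mazur_not_dvd_maninConstant_of_odd ∧ bsdRHS_eq_of_isIsogenous) ∧
      thm210_thm211_bdpDisplay_pNew)
    (hW21 : sha_dvd_analyticSha) (hF : LiuZhangZhang2018.thm151_thm153_modularCurve_heegnerVector)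
    (hD : KellerYin2024.thmD_imcMult_exists_isBDPLFunction_isTorsion_charIdeal_eq_OPEN)
    (W : WeierstrassCurve ℚ) [W.IsElliptic] [W.IsGloballyMinimal] (p : ℕ) [Fact p.Prime] (hc : CellC W p)
    (K : Type) [Field K] [NumberField K] (hK : IsImaginaryQuadratic K)
    (hodd : Odd (NumberField.discr K)) (hlt : NumberField.discr K < -4)
    (hHN : SatisfiesHeegnerHypothesis (W.conductorNorm ℤ) K) (hHp : SatisfiesHeegnerHypothesis p K)
    (hLK : (W.quadraticTwist (NumberField.discr K : ℚ)).entireLFunction 1 ≠ 0)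
    (Wd : WeierstrassCurve ℚ) [Wd.IsElliptic] [Wd.IsGloballyMinimal]
    (hWd : ∃ C : VariableChange ℚ, C • Wd = W.quadraticTwist (NumberField.discr K : ℚ))
    (Wc : WeierstrassCurve ℚ) [Wc.IsElliptic] [Wc.IsGloballyMinimal] (hiso : IsIsogenous Wd Wc)
    (hunit : ∃ q : ℚ, shaAn Wc = (q : ℂ) ∧ padicValRat p q = 0) : BSDp W p :=
  bsdp_of_cellC_of_isogenousTwistShaUnit_of_lzzRoadInputIoo_of_thmD_OPEN hPub hW21
    (X2.lzzRoadInputIoo_of_thm151_thm153 hF) hD W p hc K hK hodd hlt hHN hHp hLK Wd hWd Wc hiso hunit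

end IsogenousCensus

end Summit.BirchSwinnertonDyer.BirchSwinnertonDyer.Theorems.Reoriented

end
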